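import Mathlib.Probability.Distributions.Gaussian.HasGaussianLaw.Independence
import HarnessLib

/-!
# Tilting and shifting a centred Gaussian vector (finite-dimensional Cameron–Martin formula)

Topic `Literature/Probability/Distributions`. For a centred Gaussian random vector
`Z = (Z_i)_{i ∈ ι}` (`ι` finite) on a probability space — given abstractly through Mathlib's
`ProbabilityTheory.HasGaussianLaw (fun ω i => Z i ω) P` — and a direction `a = C c` in the range of
its covariance matrix `C_{ij} = Cov(Z_i, Z_j)` (`c : ι → ℝ` arbitrary), we prove the classical
identities

* `map_add_eq_withDensity_of_hasGaussianLaw` — **Cameron–Martin / exponential tilting**: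
  `Law(Z + a) = exp(⟨c, z⟩ - ⟨c, a⟩/2) · Law(Z)`;
* `map_neg_eq_self_of_hasGaussianLaw` — **symmetry**: `Law(-Z) = Law(Z)`;
* `map_neg_sub_eq_withDensity_of_hasGaussianLaw` — the reflected form
  `Law(-Z - a) = exp(-⟨c, z⟩ - ⟨c, a⟩/2) · Law(Z)`, with its integral (`integral_comp_neg_sub_…`) and
  lower-integral (`lintegral_comp_neg_sub_…`) versions;
* the one-dimensional input `gaussianReal_map_add_self_eq_withDensity`:
  `N(0, t) ∘ (· + t)⁻¹ = e^{y - t/2} · N(0, t)`.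

These are the finite-dimensional Cameron–Martin theorem (e.g. Bogachev, *Gaussian Measures* (1998),
Cor. 2.4.3; Janson, *Gaussian Hilbert Spaces* (1997), Thm. 14.1); all statements are [folklore].

## Proof (no densities on `ℝ^ι` are used)

The proof reduces to ONE dimension: with `Y = ⟨c, Z⟩`, `σ² = Var Y = ⟨c, a⟩`, the vector
`W = Z - (Y/σ²) a` is jointly Gaussian with `Y` and uncorrelated with it, hence independent
(Mathlib's `HasGaussianLaw.indepFun_of_covariance_eval`); `Z + a = W + ((Y + σ²)/σ²) a`, and the
law of `Y + σ²` is `e^{y - σ²/2}` times the law of `Y` (explicit Gaussian density on `ℝ`,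
`ProbabilityTheory.gaussianPDF`). Fubini over the product law of `(W, Y)` gives the tilt formula on
measurable sets. The degenerate direction `σ² = 0` forces `a = 0` and `Y = 0` a.s. The symmetry is
Mathlib's `IsGaussian.ext_covarianceBilinDual` (same mean `0`, same covariance).

## Mathlib status

Mathlib (v4.32) has Gaussian measures on Banach spaces (`IsGaussian`, characteristic function, Fernique),
`HasGaussianLaw`, `IsGaussianProcess`, independence from vanishing covariance, `multivariateGaussian`,
but no Cameron–Martin / tilting formula (searched `CameronMartin`, `tilted` + `Gaussian`,
`map_add` + `withDensity`); the real-line shift `gaussianReal_map_add_const` and density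
`gaussianReal_of_var_ne_zero` are used here. Written for the domain-Markov / sign-flip argument of
`Literature/Probability/LatticeModels/DiscreteGFFFlip.lean`.
-/

noncomputable section

open MeasureTheory ProbabilityTheory
open scoped ENNReal NNReal

namespace Literature.Probability.Distributions

/-- The Gaussian density with mean equal to its variance `t` is the centred density tilted by
`e^{y - t/2}`: `p_{t,t}(y) = p_{0,t}(y) e^{y - t/2}`. [folklore] -/
theorem gaussianPDFReal_self_eq_mul (v : ℝ≥0) (y : ℝ) :
    gaussianPDFReal (v : ℝ) v y = gaussianPDFReal 0 v y * Real.exp (y - v / 2) := by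
  rcases eq_or_ne v 0 with rfl | hv
  · simp [gaussianPDFReal]
  have hv' : (0 : ℝ) < v := by exact_mod_cast pos_iff_ne_zero.2 hv
  simp only [gaussianPDFReal, mul_assoc]
  congr 1
  rw [← Real.exp_add]
  congr 1
  field_simp
  ring

/-- **One-dimensional Cameron–Martin**: shifting `N(0, v)` by `v` tilts it by `e^{y - v/2}`
(`v ≠ 0`, stated with `v : ℝ≥0`). [folklore] -/
theorem gaussianReal_map_add_coe_eq_withDensity (v : ℝ≥0) (hv : v ≠ 0) :
    (gaussianReal 0 v).map (fun y : ℝ => y + (v : ℝ)) =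
      (gaussianReal 0 v).withDensity (fun y : ℝ => ENNReal.ofReal (Real.exp (y - v / 2))) := by
  rw [gaussianReal_map_add_const, zero_add, gaussianReal_of_var_ne_zero _ hv,
    gaussianReal_of_var_ne_zero _ hv, ← withDensity_mul _ (measurable_gaussianPDF _ _) (by fun_prop)]
  congr 1
  funext y
  simp only [Pi.mul_apply, gaussianPDF_def]
  rw [← ENNReal.ofReal_mul (gaussianPDFReal_nonneg _ _ _), gaussianPDFReal_self_eq_mul]

/-- **One-dimensional Cameron–Martin**: for `t > 0`, `N(0, t) ∘ (· + t)⁻¹ = e^{y - t/2} · N(0, t)`.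
[folklore] -/
theorem gaussianReal_map_add_self_eq_withDensity {t : ℝ} (ht : 0 < t) :
    (gaussianReal 0 t.toNNReal).map (fun y : ℝ => y + t) =
      (gaussianReal 0 t.toNNReal).withDensity
        (fun y : ℝ => ENNReal.ofReal (Real.exp (y - t / 2))) := by
  lift t to ℝ≥0 using ht.le
  rw [Real.toNNReal_coe]
  exact gaussianReal_map_add_coe_eq_withDensity t (by exact_mod_cast ht.ne')

variable {Ω : Type*} [MeasurableSpace Ω] {P : Measure Ω} {ι : Type*} [Fintype ι]

/-- **Cameron–Martin formula for a centred Gaussian vector (exponential tilting).** Let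
`Z = (Z_i)_{i ∈ ι}` be a centred Gaussian vector under `P` with covariance
`C_{ij} = Cov(Z_i, Z_j)`, let `c : ι → ℝ` and `a = C c` (i.e. `a_i = ∑_j C_{ij} c_j`). Then the law
of `Z + a` is absolutely continuous with respect to the law of `Z` with density
`z ↦ exp(∑_i c_i z_i - (∑_i c_i a_i)/2)`. (Finite-dimensional Cameron–Martin theorem; Bogachev 1998,
Cor. 2.4.3.) Proof by reduction to one dimension along `Y = ⟨c, Z⟩` (module docstring).
[folklore] -/
theorem map_add_eq_withDensity_of_hasGaussianLaw (Z : ι → Ω → ℝ)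
    (hZ : HasGaussianLaw (fun ω i => Z i ω) P) (h0 : ∀ i, ∫ ω, Z i ω ∂P = 0)
    (c a : ι → ℝ) (ha : ∀ i, a i = ∑ j, cov[Z i, Z j; P] * c j) :
    P.map (fun ω i => Z i ω + a i) =
      (P.map (fun ω i => Z i ω)).withDensity
        (fun z => ENNReal.ofReal (Real.exp (∑ i, c i * z i - (∑ i, c i * a i) / 2))) := by
  classical
  have hprob : IsProbabilityMeasure P := hZ.isProbabilityMeasure
  have hZi : ∀ i, HasGaussianLaw (Z i) P := fun i => hZ.eval i
  have hL2 : ∀ i, MemLp (Z i) 2 P := fun i => (hZi i).memLp_two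
  have hZm : AEMeasurable (fun ω i => Z i ω) P := hZ.aemeasurable
  set Y : Ω → ℝ := fun ω => ∑ j, c j * Z j ω with hY
  set s2 : ℝ := ∑ i, c i * a i with hs2
  have hYL2 : MemLp Y 2 P := by
    have := memLp_finsetSum' Finset.univ (fun j _ => (hL2 j).const_mul (c j) (p := 2) (μ := P))
    convert this using 1
    funext ω; simp [hY]
  have hYint : ∫ ω, Y ω ∂P = 0 := by
    simp only [hY]
    rw [integral_finsetSum _ (fun j _ => ((hL2 j).integrable one_le_two).const_mul (c j))]
    simp [integral_const_mul, h0]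
  have hcovZY : ∀ i, cov[Z i, Y; P] = a i := by
    intro i
    rw [hY, covariance_fun_sum_right (fun j => (hL2 j).const_mul (c j)) (hL2 i), ha]
    refine Finset.sum_congr rfl fun j _ => ?_
    rw [covariance_const_mul_right, mul_comm]
  have hvarY : Var[Y; P] = s2 := by
    rw [← covariance_self hYL2.aemeasurable]
    conv_lhs => rw [hY]
    rw [covariance_fun_sum_left (fun j => (hL2 j).const_mul (c j)) hYL2, hs2]
    refine Finset.sum_congr rfl fun j _ => ?_
    rw [covariance_const_mul_left, hcovZY]
  have hρm : Measurable fun z : ι → ℝ =>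
      ENNReal.ofReal (Real.exp (∑ i, c i * z i - s2 / 2)) := by fun_prop
  by_cases hs : s2 = 0
  · -- degenerate direction: `Y = 0` a.s., `a = 0`, density `= 1` a.s.
    have hY0 : Y =ᵐ[P] fun _ => 0 := by
      have h1 : eVar[Y; P] = 0 := by rw [← hYL2.ofReal_variance_eq, hvarY, hs, ENNReal.ofReal_zero]
      have h2 := (evariance_eq_zero_iff hYL2.aemeasurable).1 h1
      rw [hYint] at h2
      exact h2
    have ha0 : ∀ i, a i = 0 := by
      intro i
      rw [← hcovZY i, covariance]
      refine integral_eq_zero_of_ae ?_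
      filter_upwards [hY0] with ω hω
      simp [hω, hYint]
    have hlhs : (fun ω i => Z i ω + a i) = fun ω i => Z i ω := by
      funext ω i; rw [ha0, add_zero]
    rw [hlhs]
    symm
    rw [withDensity_congr_ae (g := 1), withDensity_one]
    refine (ae_map_iff hZm (measurableSet_eq_fun (g := fun _ => (1 : ℝ≥0∞)) hρm
      measurable_const)).2 ?_
    filter_upwards [hY0] with ω hω
    have : ∑ i, c i * Z i ω = 0 := hω
    simp [this, hs]
  · -- nondegenerate direction
    have hs2pos : 0 < s2 := lt_of_le_of_ne (hvarY ▸ variance_nonneg Y P) (Ne.symm hs)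
    set W : ι → Ω → ℝ := fun i ω => Z i ω - (a i / s2) * Y ω with hW
    -- joint Gaussian law of `(W, Y)` (a linear image of `Z`), `Y` as a `Unit`-indexed family
    have hWY : HasGaussianLaw (fun ω => (fun i => W i ω, fun (_ : Unit) => Y ω)) P := by
      let S : (ι → ℝ) →ₗ[ℝ] ℝ := ∑ j, c j • LinearMap.proj j
      have hS : ∀ z : ι → ℝ, S z = ∑ j, c j * z j := fun z => by
        simp [S, LinearMap.sum_apply]
      let L : (ι → ℝ) →ₗ[ℝ] (ι → ℝ) × (Unit → ℝ) :=
        (LinearMap.id - LinearMap.pi fun i => (a i / s2) • S).prod (LinearMap.pi fun _ => S)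
      have hL : ∀ ω, L (fun i => Z i ω) = (fun i => W i ω, fun (_ : Unit) => Y ω) := fun ω => by
        ext i
        · simp [L, hS, hW, hY]
        · simp [L, hS, hY]
      have := hZ.map (LinearMap.toContinuousLinearMap L)
      refine this.congr (Filter.Eventually.of_forall fun ω => ?_)
      exact hL ω
    have hcov0 : ∀ (i : ι) (j : Unit), cov[W i, (fun (_ : Unit) (ω : Ω) => Y ω) j; P] = 0 := by
      intro i _
      change cov[fun ω => Z i ω - (a i / s2) * Y ω, fun ω => Y ω; P] = 0
      rw [covariance_fun_sub_left (hL2 i) (hYL2.const_mul _) hYL2, covariance_const_mul_left,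
        covariance_self hYL2.aemeasurable, hvarY, hcovZY]
      field_simp
      ring
    have hind : IndepFun (fun ω i => W i ω) (fun ω (_ : Unit) => Y ω) P :=
      hWY.indepFun_of_covariance_eval hcov0
    have hind' : IndepFun (fun ω i => W i ω) Y P := by
      have := hind.comp measurable_id (measurable_pi_apply ())
      exact this
    have hYG : HasGaussianLaw Y P := hWY.snd.eval ()
    have hYlaw : P.map Y = gaussianReal 0 s2.toNNReal := by
      rw [hYG.map_eq_gaussianReal, hYint, hvarY]
    have hWm : AEMeasurable (fun ω i => W i ω) P := hWY.fst.aemeasurable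
    have hYm : AEMeasurable Y P := hYG.aemeasurable
    have hpair : P.map (fun ω => (fun i => W i ω, Y ω)) =
        (P.map (fun ω i => W i ω)).prod (gaussianReal 0 s2.toNNReal) := by
      rw [(indepFun_iff_map_prod_eq_prod_map_map hWm hYm).1 hind', hYlaw]
    have hZW : ∀ ω i, Z i ω = W i ω + (Y ω / s2) * a i := by
      intro ω i; simp only [hW]; field_simp; ring
    -- the common value of both sides on a measurable set
    set γ : Measure ℝ := gaussianReal 0 s2.toNNReal with hγ
    set ρ1 : ℝ → ℝ≥0∞ := fun y => ENNReal.ofReal (Real.exp (y - s2 / 2)) with hρ1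
    have hρ1m : Measurable ρ1 := by fun_prop
    ext s hs
    have hmeasT : ∀ w : ι → ℝ, MeasurableSet {y : ℝ | (fun i => w i + (y / s2) * a i) ∈ s} :=
      fun w => (by fun_prop : Measurable fun y : ℝ => fun i => w i + (y / s2) * a i) hs
    set S0 : Set ((ι → ℝ) × ℝ) := {q | (fun i => q.1 i + (q.2 / s2) * a i) ∈ s} with hS0
    have hS0m : MeasurableSet S0 :=
      (by fun_prop : Measurable fun q : (ι → ℝ) × ℝ => fun i => q.1 i + (q.2 / s2) * a i) hs
    set S1 : Set ((ι → ℝ) × ℝ) := {q | (fun i => q.1 i + ((q.2 + s2) / s2) * a i) ∈ s} with hS1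
    have hS1m : MeasurableSet S1 :=
      (by fun_prop : Measurable fun q : (ι → ℝ) × ℝ => fun i => q.1 i + ((q.2 + s2) / s2) * a i) hs
    have hpairm : AEMeasurable (fun ω => (fun i => W i ω, Y ω)) P := hWm.prodMk hYm
    -- left-hand side
    have hL : P.map (fun ω i => Z i ω + a i) s =
        ∫⁻ w, ∫⁻ y in {y : ℝ | (fun i => w i + (y / s2) * a i) ∈ s}, ρ1 y ∂γ
          ∂(P.map (fun ω i => W i ω)) := by
      have h1 : (fun ω i => Z i ω + a i) ⁻¹' s = (fun ω => (fun i => W i ω, Y ω)) ⁻¹' S1 := by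
        ext ω
        simp only [Set.mem_preimage, hS1, Set.mem_setOf_eq]
        have : (fun i => Z i ω + a i) = fun i => W i ω + ((Y ω + s2) / s2) * a i := by
          funext i; rw [hZW]; field_simp; ring
        rw [this]
      rw [Measure.map_apply_of_aemeasurable (by fun_prop) hs, h1,
        ← Measure.map_apply_of_aemeasurable hpairm hS1m, hpair, Measure.prod_apply hS1m]
      refine lintegral_congr fun w => ?_
      have h2 : Prod.mk w ⁻¹' S1 =
          (fun y : ℝ => y + s2) ⁻¹' {y : ℝ | (fun i => w i + (y / s2) * a i) ∈ s} := by
        ext y; simp [hS1]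
      rw [h2, ← Measure.map_apply (measurable_add_const _) (hmeasT w), hγ,
        gaussianReal_map_add_self_eq_withDensity hs2pos, withDensity_apply _ (hmeasT w)]
    -- right-hand side
    have hR : ((P.map (fun ω i => Z i ω)).withDensity
          (fun z => ENNReal.ofReal (Real.exp (∑ i, c i * z i - s2 / 2)))) s =
        ∫⁻ w, ∫⁻ y in {y : ℝ | (fun i => w i + (y / s2) * a i) ∈ s}, ρ1 y ∂γ
          ∂(P.map (fun ω i => W i ω)) := by
      set G : (ι → ℝ) × ℝ → ℝ≥0∞ := S0.indicator fun q => ρ1 q.2 with hG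
      have hGm : Measurable G := (hρ1m.comp measurable_snd).indicator hS0m
      rw [withDensity_apply _ hs, ← lintegral_indicator hs,
        lintegral_map' ((hρm.indicator hs).aemeasurable) hZm]
      have h3 : (fun ω => s.indicator (fun z : ι → ℝ =>
          ENNReal.ofReal (Real.exp (∑ i, c i * z i - s2 / 2))) (fun i => Z i ω)) =
          fun ω => G (fun i => W i ω, Y ω) := by
        funext ω
        have hz : (fun i => Z i ω) = fun i => W i ω + (Y ω / s2) * a i := funext (hZW ω)
        simp only [hG, Set.indicator, Set.mem_setOf_eq, hS0]
        rw [hz]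
      rw [h3, ← lintegral_map' hGm.aemeasurable hpairm, hpair, lintegral_prod _ hGm.aemeasurable]
      refine lintegral_congr fun w => ?_
      rw [← lintegral_indicator (hmeasT w)]
      refine lintegral_congr fun y => ?_
      rfl
    rw [hL, hR]

/-- The law of a centred random vector has mean `0` (as a Bochner integral in `ι → ℝ`). [folklore] -/
theorem integral_id_map_eq_zero_of_forall (Z : ι → Ω → ℝ)
    (hZ : HasGaussianLaw (fun ω i => Z i ω) P) (h0 : ∀ i, ∫ ω, Z i ω ∂P = 0) :
    ∫ z, z ∂(P.map (fun ω i => Z i ω)) = 0 := by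
  rw [integral_map (f := fun z : ι → ℝ => z) hZ.aemeasurable aestronglyMeasurable_id]
  funext i
  have := (ContinuousLinearMap.proj (R := ℝ) (φ := fun _ : ι => ℝ) i).integral_comp_comm
    hZ.integrable
  simp only [ContinuousLinearMap.proj_apply] at this
  rw [Pi.zero_apply, ← this, h0]

/-- **A centred Gaussian vector is symmetric**: `Law(-Z) = Law(Z)` (two Gaussian measures with the
same mean and covariance coincide, Mathlib's `IsGaussian.ext_covarianceBilinDual`). [folklore] -/
theorem map_neg_eq_self_of_hasGaussianLaw (Z : ι → Ω → ℝ)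
    (hZ : HasGaussianLaw (fun ω i => Z i ω) P) (h0 : ∀ i, ∫ ω, Z i ω ∂P = 0) :
    P.map (fun ω i => -Z i ω) = P.map (fun ω i => Z i ω) := by
  have hprob : IsProbabilityMeasure P := hZ.isProbabilityMeasure
  set μ : Measure (ι → ℝ) := P.map (fun ω i => Z i ω) with hμ
  have hGauss : IsGaussian μ := hZ.isGaussian_map
  have hnegm : Measurable fun z : ι → ℝ => -z := measurable_neg
  have hneg : P.map (fun ω i => -Z i ω) = μ.map (fun z : ι → ℝ => -z) := by
    rw [hμ, AEMeasurable.map_map_of_aemeasurable hnegm.aemeasurable hZ.aemeasurable]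
    rfl
  rw [hneg]
  have hmean : ∫ z, z ∂μ = 0 := integral_id_map_eq_zero_of_forall Z hZ h0
  have h2 : MemLp id 2 μ := IsGaussian.memLp_two_id
  have h2' : MemLp id 2 (μ.map fun z : ι → ℝ => -z) := IsGaussian.memLp_two_id
  refine IsGaussian.ext_covarianceBilinDual ?_ ?_
  · simp only [id_eq]
    rw [integral_map (f := fun z : ι → ℝ => z) hnegm.aemeasurable aestronglyMeasurable_id,
      integral_neg, hmean, neg_zero]
  · ext L₁ L₂
    rw [covarianceBilinDual_eq_covariance h2', covarianceBilinDual_eq_covariance h2,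
      covariance_map (by fun_prop) (by fun_prop) hnegm.aemeasurable]
    have e1 : (L₁ : (ι → ℝ) → ℝ) ∘ (fun z : ι → ℝ => -z) = fun z => -L₁ z := by
      funext z; simp
    have e2 : (L₂ : (ι → ℝ) → ℝ) ∘ (fun z : ι → ℝ => -z) = fun z => -L₂ z := by
      funext z; simp
    rw [e1, e2, covariance_fun_neg_left, covariance_fun_neg_right, neg_neg]

/-- **Reflected Cameron–Martin formula**: with `a = C c` as above,
`Law(-Z - a) = exp(-∑_i c_i z_i - (∑_i c_i a_i)/2) · Law(Z)` (tilting applied to `-Z`, then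
symmetry). This is the form in which a sign flip `f ↦ -f` of an affine image `f = m + Z` acts on
the Gaussian law. [folklore] -/
theorem map_neg_sub_eq_withDensity_of_hasGaussianLaw (Z : ι → Ω → ℝ)
    (hZ : HasGaussianLaw (fun ω i => Z i ω) P) (h0 : ∀ i, ∫ ω, Z i ω ∂P = 0)
    (c a : ι → ℝ) (ha : ∀ i, a i = ∑ j, cov[Z i, Z j; P] * c j) :
    P.map (fun ω i => -Z i ω - a i) =
      (P.map (fun ω i => Z i ω)).withDensity
        (fun z => ENNReal.ofReal (Real.exp (-∑ i, c i * z i - (∑ i, c i * a i) / 2))) := by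
  have hprob : IsProbabilityMeasure P := hZ.isProbabilityMeasure
  have hZ' : HasGaussianLaw (fun ω i => -Z i ω) P := by
    have := hZ.neg
    exact this
  have h0' : ∀ i, ∫ ω, -Z i ω ∂P = 0 := fun i => by rw [integral_neg, h0, neg_zero]
  have ha' : ∀ i, -a i = ∑ j, cov[fun ω => -Z i ω, fun ω => -Z j ω; P] * (-c j) := by
    intro i
    rw [ha, ← Finset.sum_neg_distrib]
    refine Finset.sum_congr rfl fun j _ => ?_
    rw [covariance_fun_neg_left, covariance_fun_neg_right]
    ring
  have h := map_add_eq_withDensity_of_hasGaussianLaw (fun i ω => -Z i ω) hZ' h0' (fun j => -c j)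
    (fun i => -a i) ha'
  rw [map_neg_eq_self_of_hasGaussianLaw Z hZ h0] at h
  convert h using 3 with ω z
  · simp [sub_eq_add_neg]
  · congr 2
    simp only [neg_mul, Finset.sum_neg_distrib, mul_neg, neg_neg]

/-- Integral form of `map_neg_sub_eq_withDensity_of_hasGaussianLaw`: for measurable real `F`,
`E[F(-Z - a)] = E[exp(-⟨c, Z⟩ - ⟨c, a⟩/2) F(Z)]` (no integrability hypothesis: both Bochner
integrals vanish together). [folklore] -/
theorem integral_comp_neg_sub_of_hasGaussianLaw (Z : ι → Ω → ℝ)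
    (hZ : HasGaussianLaw (fun ω i => Z i ω) P) (h0 : ∀ i, ∫ ω, Z i ω ∂P = 0)
    (c a : ι → ℝ) (ha : ∀ i, a i = ∑ j, cov[Z i, Z j; P] * c j)
    {F : (ι → ℝ) → ℝ} (hF : Measurable F) :
    ∫ ω, F (fun i => -Z i ω - a i) ∂P =
      ∫ ω, Real.exp (-∑ i, c i * Z i ω - (∑ i, c i * a i) / 2) * F (fun i => Z i ω) ∂P := by
  have hm : AEMeasurable (fun ω i => -Z i ω - a i) P :=
    (by fun_prop : Measurable fun z : ι → ℝ => fun i => -z i - a i).comp_aemeasurable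
      hZ.aemeasurable
  rw [← integral_map hm hF.aestronglyMeasurable,
    map_neg_sub_eq_withDensity_of_hasGaussianLaw Z hZ h0 c a ha,
    integral_withDensity_eq_integral_toReal_smul (by fun_prop)
      (Filter.Eventually.of_forall fun _ => ENNReal.ofReal_lt_top),
    integral_map hZ.aemeasurable]
  · refine integral_congr_ae (Filter.Eventually.of_forall fun ω => ?_)
    simp only [smul_eq_mul]
    rw [ENNReal.toReal_ofReal (Real.exp_nonneg _)]
  · exact (Measurable.aestronglyMeasurable (by fun_prop))

/-- Lower-integral form of `map_neg_sub_eq_withDensity_of_hasGaussianLaw`: for measurable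
`F ≥ 0`, `∫⁻ F(-Z - a) dP = ∫⁻ F(Z) exp(-⟨c, Z⟩ - ⟨c, a⟩/2) dP`. [folklore] -/
theorem lintegral_comp_neg_sub_of_hasGaussianLaw (Z : ι → Ω → ℝ)
    (hZ : HasGaussianLaw (fun ω i => Z i ω) P) (h0 : ∀ i, ∫ ω, Z i ω ∂P = 0)
    (c a : ι → ℝ) (ha : ∀ i, a i = ∑ j, cov[Z i, Z j; P] * c j)
    {F : (ι → ℝ) → ℝ≥0∞} (hF : Measurable F) :
    ∫⁻ ω, F (fun i => -Z i ω - a i) ∂P =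
      ∫⁻ ω, F (fun i => Z i ω) *
        ENNReal.ofReal (Real.exp (-∑ i, c i * Z i ω - (∑ i, c i * a i) / 2)) ∂P := by
  have hm : AEMeasurable (fun ω i => -Z i ω - a i) P :=
    (by fun_prop : Measurable fun z : ι → ℝ => fun i => -z i - a i).comp_aemeasurable
      hZ.aemeasurable
  have hρ : Measurable fun z : ι → ℝ =>
      ENNReal.ofReal (Real.exp (-∑ i, c i * z i - (∑ i, c i * a i) / 2)) := by fun_prop
  rw [← lintegral_map' hF.aemeasurable hm, map_neg_sub_eq_withDensity_of_hasGaussianLaw Z hZ h0 c a ha,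
    lintegral_withDensity_eq_lintegral_mul _ hρ hF,
    lintegral_map' (hρ.mul hF).aemeasurable hZ.aemeasurable]
  refine lintegral_congr fun z => ?_
  simp only [Pi.mul_apply, mul_comm]

end Literature.Probability.Distributions

end
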